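/-
Copyright (c) 2026 the pub-hodgecm-mathlib formalisation cell (harness21).  Prover seat hodgecm-mathlib-K2E5-p16 (g4): Track B «K2-LIT»,
hLiu418 = stmt-HodgeConjecture-24832, ROAD Φ organ Φ6b-4 (c) (dealer K2E5-plan (g5) 2026-09-04T06:55:23Z: «the growth ∕ continuity in (g, h) of Ξ
locally uniformly in α — what the Fourier-expansion continuation Φ6b-5 will sum»): GROWTH OF `η(g, h; α, β)` IN `h`, UNIFORM ON `α`-STRIPS; 2026-09-04.
-/
import Summits.HodgeConjecture.HodgeConjecture.Theorems.K2LiuHermTwoEtaConvergence             -- ★ p857940 (this seat): convergence of `η`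
import Summits.HodgeConjecture.HodgeConjecture.Theorems.K2LiuHermTwoConfluentXiHolomorphy     -- ★ p857877: brings ★ `rpow_neg_le_add`
import HarnessLib

/-!
# Crux `HLiu418`, ROAD Φ, organ Φ6b-4 (c): the growth of `η(g, h; α, β)` in `h > 0`, uniformly for `re α` in a compact interval
# [Shimura1982, Thm 3.1 (ii)-type estimate, Case II, m = κ = 2]

Cell `hodgecm-mathlib`, crux item hLiu418 = `stmt-HodgeConjecture-24832`, route of record `HCCMUnconditional`; squad K2, LEAD F0P6-plan (g12), co-dealer
K2E5-plan (g5), prover K2E5-p16 (g4).  THEOREMS ONLY; lane `--supports stmt-HodgeConjecture-24832 --as helper`.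

THE ESTIMATE (`norm_etaTwo_le`).  For `g > 0`, `re β > 1` and reals `a₁ ≤ a₂` there is `C ≥ 0` such that for EVERY `h > 0` and every `α` with
`a₁ ≤ re α ≤ a₂`:
  `|η(g, h; α, β)| ≤ C · e^{−Re tr(hg)} · (1 + tr h)^{2(a₂−2)⁺} · (1 + det(h)^{−(2−a₁)⁺})`.
This is what the Fourier-expansion continuation sums: with `h` in a lattice (`det h ≥ δ_L > 0`) and coefficients of polynomial growth the series
`Σ_h c_h Ξ(y, h; α, β) e(tr hx)` converges locally uniformly in `α` (the factors `e^{iπ(β−α)} Γ₂(α)⁻¹` are continuous in `α`).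
PROOF.  `x = u + h`: `|η-integrand(u + h)| = e^{−τ(ug) − τ(hg)} det(u + 2h)^{re α − 2} det(u)^{re β − 2}` (`norm_etaTwoIntegrand_add`); interpolation
`det(u+2h)^{a−2} ≤ det(u+2h)^{a₁−2} + det(u+2h)^{a₂−2}` (★ `rpow_neg_le_add`) reduces to REAL exponents `a`; for `a ≥ 2`,
`det(u + 2h) ≤ (2(1 + tr h)·det(u + 1))²` and `∫ e^{−τ(ug)} det(u+1)^{2(a−2)} det(u)^{re β−2} du < ∞` is ★ `integrableOn_etaTwoIntegrand_of_posDef` at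
`h = ½`; for `a < 2`, `det(u + 2h)^{a−2} ≤ det(h)^{a−2}` and `∫ e^{−τ(ug)} det(u)^{re β − 2} du < ∞` is ★ Siegel–Gindikin.
HONEST LABEL.  Count-neutral helper of the K2_Liu road; it pays no socket by itself: `HC_CM` is proved only modulo the 7 printed citations
(2 remaining named inputs: hLiu418 = `stmt-HodgeConjecture-24832`, h413 = `stmt-HodgeConjecture-24833`) until rung 0 closes.
-/

set_option autoImplicit false
-- the mandated namespace repeats the single-problem summit's segment (`HodgeConjecture.HodgeConjecture`)
set_option linter.dupNamespace false

noncomputable section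

open Complex MeasureTheory Set
open scoped ComplexOrder ComplexConjugate

namespace Summit.HodgeConjecture.HodgeConjecture.Cruxes.HLiu418.K2LiuHermTwoEtaGrowth

open Summit.HodgeConjecture.HodgeConjecture.Cruxes.HLiu418.K2LiuHermTwoGammaDefs
open Summit.HodgeConjecture.HodgeConjecture.Cruxes.HLiu418.K2LiuHermTwoGammaSiegelGindikin
open Summit.HodgeConjecture.HodgeConjecture.Cruxes.HLiu418.K2LiuHermTwoEtaDefs
open Summit.HodgeConjecture.HodgeConjecture.Cruxes.HLiu418.K2LiuHermTwoEtaConvergence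

/-! ## The translation `x = u + h` -/

/-- Translations preserve Lebesgue measure on the chart `ℝ × ℂ × ℝ`. -/
theorem measurePreserving_add_const (e : ℝ × ℂ × ℝ) : MeasurePreserving (fun c : ℝ × ℂ × ℝ => c + e) volume volume := by
  have h := (measurePreserving_add_right (volume : Measure ℝ) e.1).prod
    ((measurePreserving_add_right (volume : Measure ℂ) e.2.1).prod (measurePreserving_add_right (volume : Measure ℝ) e.2.2))
  have hf : (fun c : ℝ × ℂ × ℝ => c + e) =
      Prod.map (fun x : ℝ => x + e.1) (Prod.map (fun x : ℂ => x + e.2.1) (fun x : ℝ => x + e.2.2)) := by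
    funext c
    rfl
  rw [hf, Measure.volume_eq_prod, Measure.volume_eq_prod]
  exact h

/-- The preimage of the domain `{x − h > 0}` under `u ↦ u + h` is the cone. -/
theorem preimage_add_const (e : ℝ × ℂ × ℝ) :
    (fun c : ℝ × ℂ × ℝ => c + e) ⁻¹' {c | (hermTwo c - hermTwo e).PosDef} = {c | (hermTwo c).PosDef} := by
  ext c
  simp only [Set.mem_preimage, Set.mem_setOf_eq, hermTwo_add, add_sub_cancel_right]

/-- `η(g, h; α, β) = ∫_{u > 0} (η-integrand)(u + h) du` for `h = hermTwo e ≥ 0`. -/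
theorem etaTwo_eq_integral_comp_add (g : Matrix (Fin 2) (Fin 2) ℂ) {e : ℝ × ℂ × ℝ} (he : (hermTwo e).PosSemidef) (α β : ℂ) :
    etaTwo g (hermTwo e) α β = ∫ u in {c : ℝ × ℂ × ℝ | (hermTwo c).PosDef}, etaTwoIntegrand g (hermTwo e) α β (u + e) := by
  rw [etaTwo_def, etaTwoSet_eq_of_posSemidef he,
    ← (measurePreserving_add_const e).setIntegral_preimage_emb (MeasurableEquiv.addRight e).measurableEmbedding, preimage_add_const]

/-- Integrability of the translated integrand on the cone (`g, h > 0`, `re β > 1`, any `α`). -/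
theorem integrableOn_etaTwoIntegrand_comp_add {g : Matrix (Fin 2) (Fin 2) ℂ} (hg : g.PosDef) {e : ℝ × ℂ × ℝ} (he : (hermTwo e).PosDef)
    (α : ℂ) {β : ℂ} (hβ : 1 < β.re) :
    IntegrableOn (fun u : ℝ × ℂ × ℝ => etaTwoIntegrand g (hermTwo e) α β (u + e)) {c : ℝ × ℂ × ℝ | (hermTwo c).PosDef} := by
  have h := integrableOn_etaTwoIntegrand_of_posDef hg he α hβ
  rw [etaTwoSet_eq_of_posSemidef he.posSemidef] at h
  rw [← preimage_add_const e]
  exact ((measurePreserving_add_const e).integrableOn_comp_preimage (MeasurableEquiv.addRight e).measurableEmbedding).mpr h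

/-! ## The translated integrand in the chart -/

/-- THE NORM OF THE TRANSLATED INTEGRAND: for `u = (a, z, b)` in the cone, `g = hermTwo d`, `h = hermTwo e > 0`,
`|η-integrand(u + h)| = e^{−(τ(ug) + τ(hg))} · det(u + 2h)^{re γ − 2} · det(u)^{re β − 2}`. -/
theorem norm_etaTwoIntegrand_add (d : ℝ × ℂ × ℝ) {e : ℝ × ℂ × ℝ} (he : (hermTwo e).PosDef) {a b : ℝ} {z : ℂ} (ha : 0 < a)
    (hz : normSq z < a * b) (γ β : ℂ) :
    ‖etaTwoIntegrand (hermTwo d) (hermTwo e) γ β ((a, z, b) + e)‖ =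
      Real.exp (-((a * d.1 + b * d.2.2 + 2 * (z * conj d.2.1).re) + (e.1 * d.1 + e.2.2 * d.2.2 + 2 * (e.2.1 * conj d.2.1).re))) *
        (((a + (e.1 + e.1)) * (b + (e.2.2 + e.2.2)) - normSq (z + (e.2.1 + e.2.1))) ^ (γ.re - 2) * (a * b - normSq z) ^ (β.re - 2)) := by
  have heh := (posDef_hermTwo_iff e).mp he
  have h2e := (posDef_hermTwo_iff (e + e)).mp (by rw [hermTwo_add]; exact he.add he)
  have hdetx : 0 < a * b - normSq z := by linarith
  have hdet2 : 0 < (a + (e.1 + e.1)) * (b + (e.2.2 + e.2.2)) - normSq (z + (e.2.1 + e.2.1)) := by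
    have := det_add_ge (w := (e + e).2.1) (q := (e + e).2.2) ha hz h2e.1 h2e.2
    simp only [Prod.fst_add, Prod.snd_add] at this
    linarith [h2e.2, show normSq (e + e).2.1 = normSq (e.2.1 + e.2.1) by rfl,
      show (e + e).1 * (e + e).2.2 = (e.1 + e.1) * (e.2.2 + e.2.2) by rfl]
  have hL1 : ‖cexp (-(hermTwo ((a, z, b) + e) * hermTwo d).trace)‖ =
      Real.exp (-((a * d.1 + b * d.2.2 + 2 * (z * conj d.2.1).re) + (e.1 * d.1 + e.2.2 * d.2.2 + 2 * (e.2.1 * conj d.2.1).re))) := by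
    rw [Complex.norm_exp, trace_hermTwo_mul_hermTwo]
    congr 1
    simp only [Prod.fst_add, Prod.snd_add, neg_re, ofReal_re, add_mul, Complex.add_re, mul_add]
    ring
  have hL2 : ‖(hermTwo ((a, z, b) + e + e)).det ^ (γ - 2)‖ =
      ((a + (e.1 + e.1)) * (b + (e.2.2 + e.2.2)) - normSq (z + (e.2.1 + e.2.1))) ^ (γ.re - 2) := by
    have hx : (a, z, b) + e + e = (a + (e.1 + e.1), z + (e.2.1 + e.2.1), b + (e.2.2 + e.2.2)) := by
      ext <;> simp [add_assoc]
    rw [hx, det_hermTwo, norm_cpow_eq_rpow_re_of_pos hdet2]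
    simp
  have hL3 : ‖(hermTwo (a, z, b)).det ^ (β - 2)‖ = (a * b - normSq z) ^ (β.re - 2) := by
    rw [det_hermTwo, norm_cpow_eq_rpow_re_of_pos hdetx]
    simp
  rw [etaTwoIntegrand_add, norm_mul, norm_mul, hL1, hL2, hL3]

/-- INTERPOLATION IN `re α`: on the cone, for `a₁ ≤ re γ ≤ a₂`,
`|η-integrand(γ)(u + h)| ≤ |η-integrand(a₁)(u + h)| + |η-integrand(a₂)(u + h)|` (real exponents at the endpoints). -/
theorem norm_etaTwoIntegrand_add_le_add (d : ℝ × ℂ × ℝ) {e : ℝ × ℂ × ℝ} (he : (hermTwo e).PosDef) {u : ℝ × ℂ × ℝ}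
    (hu : (hermTwo u).PosDef) {γ β : ℂ} {a₁ a₂ : ℝ} (h₁ : a₁ ≤ γ.re) (h₂ : γ.re ≤ a₂) :
    ‖etaTwoIntegrand (hermTwo d) (hermTwo e) γ β (u + e)‖ ≤
      ‖etaTwoIntegrand (hermTwo d) (hermTwo e) (a₁ : ℂ) β (u + e)‖ + ‖etaTwoIntegrand (hermTwo d) (hermTwo e) (a₂ : ℂ) β (u + e)‖ := by
  have hu' := (posDef_hermTwo_iff u).mp hu
  obtain ⟨a, z, b⟩ := u
  obtain ⟨ha, hz⟩ := hu'
  rw [norm_etaTwoIntegrand_add d he ha hz, norm_etaTwoIntegrand_add d he ha hz, norm_etaTwoIntegrand_add d he ha hz, ofReal_re, ofReal_re]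
  have h2e := (posDef_hermTwo_iff (e + e)).mp (by rw [hermTwo_add]; exact he.add he)
  have hdet2 : 0 < (a + (e.1 + e.1)) * (b + (e.2.2 + e.2.2)) - normSq (z + (e.2.1 + e.2.1)) := by
    have := det_add_ge (w := (e + e).2.1) (q := (e + e).2.2) ha hz h2e.1 h2e.2
    simp only [Prod.fst_add, Prod.snd_add] at this
    linarith [h2e.2, show normSq (e + e).2.1 = normSq (e.2.1 + e.2.1) by rfl,
      show (e + e).1 * (e + e).2.2 = (e.1 + e.1) * (e.2.2 + e.2.2) by rfl]
  have hpow := Literature.Dynamics.TransferOperators.rpow_neg_le_add (a := 2 - γ.re) (a₁ := 2 - a₂) (a₂ := 2 - a₁) hdet2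
    (by linarith) (by linarith)
  rw [neg_sub, neg_sub, neg_sub] at hpow
  have hE : 0 ≤ Real.exp (-((a * d.1 + b * d.2.2 + 2 * (z * conj d.2.1).re) + (e.1 * d.1 + e.2.2 * d.2.2 + 2 * (e.2.1 * conj d.2.1).re))) :=
    (Real.exp_pos _).le
  have hD : 0 ≤ (a * b - normSq z) ^ (β.re - 2) := Real.rpow_nonneg (by linarith) _
  nlinarith [mul_nonneg hE hD, hpow]

/-! ## Pointwise bounds at a real exponent -/

/-- For `u` in the cone and `h ≥ 0` (chart): `det(u + 2h) ≤ (2 (1 + tr h) · det(u + 1))²`. -/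
theorem det_add_le_sq {a b : ℝ} {z : ℂ} (ha : 0 < a) (hz : normSq z < a * b) {e : ℝ × ℂ × ℝ} (he1 : 0 ≤ e.1) (he2 : 0 ≤ e.2.2) :
    (a + (e.1 + e.1)) * (b + (e.2.2 + e.2.2)) - normSq (z + (e.2.1 + e.2.1)) ≤
      (2 * (1 + (e.1 + e.2.2)) * ((a + 1) * (b + 1) - normSq z)) ^ 2 := by
  have hb : 0 < b := snd_pos_of_cone ha hz
  have h1 := det_le_trace_sq (a + (e.1 + e.1)) (b + (e.2.2 + e.2.2)) (z + (e.2.1 + e.2.1))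
  have h2 : a + (e.1 + e.1) + (b + (e.2.2 + e.2.2)) ≤ 2 * (1 + (e.1 + e.2.2)) * ((a + 1) * (b + 1) - normSq z) := by
    nlinarith [mul_nonneg (add_nonneg he1 he2) (add_nonneg ha.le hb.le),
      mul_nonneg (add_nonneg zero_le_one (add_nonneg he1 he2)) (sub_nonneg.mpr hz.le)]
  have h0 : 0 ≤ a + (e.1 + e.1) + (b + (e.2.2 + e.2.2)) := by linarith
  exact h1.trans (pow_le_pow_left₀ h0 h2 2)

/-- THE BOUND AT A REAL EXPONENT `a ≥ 2`: `|η-int(a)(u + h)| ≤ e^{−τ(hg)} (2(1 + tr h))^{2(a−2)} · e^{τ(g)/2} |η-int(g, ½; 2a − 2, β)(u + ½)|`. -/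
theorem norm_etaTwoIntegrand_add_le_of_two_le (d : ℝ × ℂ × ℝ) {e : ℝ × ℂ × ℝ} (he : (hermTwo e).PosDef) {u : ℝ × ℂ × ℝ}
    (hu : (hermTwo u).PosDef) {a : ℝ} (ha2 : 2 ≤ a) (β : ℂ) :
    ‖etaTwoIntegrand (hermTwo d) (hermTwo e) (a : ℂ) β (u + e)‖ ≤
      (Real.exp (-(e.1 * d.1 + e.2.2 * d.2.2 + 2 * (e.2.1 * conj d.2.1).re)) * (2 * (1 + (e.1 + e.2.2))) ^ (2 * (a - 2))) *
        (Real.exp ((d.1 + d.2.2) / 2) *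
          ‖etaTwoIntegrand (hermTwo d) (hermTwo ((1 / 2 : ℝ), (0 : ℂ), (1 / 2 : ℝ))) ((2 * a - 2 : ℝ) : ℂ) β
            (u + ((1 / 2 : ℝ), (0 : ℂ), (1 / 2 : ℝ)))‖) := by
  have hu' := (posDef_hermTwo_iff u).mp hu
  have heh := (posDef_hermTwo_iff e).mp he
  obtain ⟨x, z, y⟩ := u
  obtain ⟨hx, hz⟩ := hu'
  have hy : 0 < y := snd_pos_of_cone hx hz
  have he2 : 0 < e.2.2 := snd_pos_of_cone heh.1 heh.2
  have hι : (hermTwo ((1 / 2 : ℝ), (0 : ℂ), (1 / 2 : ℝ))).PosDef := (posDef_hermTwo_iff _).mpr (by norm_num)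
  rw [norm_etaTwoIntegrand_add d he hx hz, norm_etaTwoIntegrand_add d hι hx hz, ofReal_re, ofReal_re]
  simp only [zero_mul, Complex.zero_re, mul_zero, add_zero]
  -- names
  set T : ℝ := x * d.1 + y * d.2.2 + 2 * (z * conj d.2.1).re with hT
  set Te : ℝ := e.1 * d.1 + e.2.2 * d.2.2 + 2 * (e.2.1 * conj d.2.1).re with hTe
  set p₂ : ℝ := (x + (e.1 + e.1)) * (y + (e.2.2 + e.2.2)) - normSq (z + (e.2.1 + e.2.1)) with hp₂
  set pI : ℝ := (x + 1) * (y + 1) - normSq z with hpI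
  set D : ℝ := x * y - normSq z with hD
  have hDpos : 0 < D := by rw [hD]; linarith
  have hpI1 : 1 ≤ pI := by rw [hpI]; nlinarith
  have hp₂pos : 0 < p₂ := by
    have h2e := (posDef_hermTwo_iff (e + e)).mp (by rw [hermTwo_add]; exact he.add he)
    have := det_add_ge (w := (e + e).2.1) (q := (e + e).2.2) hx hz h2e.1 h2e.2
    simp only [Prod.fst_add, Prod.snd_add] at this
    rw [hp₂]
    linarith [h2e.2, show normSq (e + e).2.1 = normSq (e.2.1 + e.2.1) by rfl,
      show (e + e).1 * (e + e).2.2 = (e.1 + e.1) * (e.2.2 + e.2.2) by rfl]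
  -- `p₂^{a−2} ≤ (2(1 + tr h))^{2(a−2)} · pI^{2a − 4}`
  have hsq : p₂ ≤ (2 * (1 + (e.1 + e.2.2)) * pI) ^ 2 := det_add_le_sq hx hz heh.1.le he2.le
  have hK0 : 0 ≤ 2 * (1 + (e.1 + e.2.2)) := by linarith [heh.1]
  have hpow : p₂ ^ (a - 2) ≤ (2 * (1 + (e.1 + e.2.2))) ^ (2 * (a - 2)) * pI ^ (2 * a - 2 - 2) := by
    calc p₂ ^ (a - 2) ≤ ((2 * (1 + (e.1 + e.2.2)) * pI) ^ 2) ^ (a - 2) := Real.rpow_le_rpow hp₂pos.le hsq (by linarith)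
      _ = (2 * (1 + (e.1 + e.2.2)) * pI) ^ (2 * (a - 2)) := by
          rw [show ((2 * (1 + (e.1 + e.2.2)) * pI) ^ 2 : ℝ) = (2 * (1 + (e.1 + e.2.2)) * pI) ^ (2 : ℝ) by norm_cast,
            ← Real.rpow_mul (by positivity)]
      _ = (2 * (1 + (e.1 + e.2.2))) ^ (2 * (a - 2)) * pI ^ (2 * a - 2 - 2) := by
          rw [Real.mul_rpow hK0 (by linarith), show 2 * a - 2 - 2 = 2 * (a - 2) by ring]
  -- the `½`-shifted quantities
  have hι1 : (x + (1 / 2 + 1 / 2)) * (y + (1 / 2 + 1 / 2)) - normSq z = pI := by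
    rw [hpI]
    norm_num
  have hι2 : 1 / 2 * d.1 + 1 / 2 * d.2.2 = (d.1 + d.2.2) / 2 := by ring
  rw [hι1, hι2]
  have hE : Real.exp (-(T + Te)) = Real.exp (-Te) * (Real.exp ((d.1 + d.2.2) / 2) * Real.exp (-(T + (d.1 + d.2.2) / 2))) := by
    rw [← Real.exp_add, ← Real.exp_add]
    congr 1
    ring
  rw [hE]
  have h0 : 0 ≤ Real.exp (-Te) * (Real.exp ((d.1 + d.2.2) / 2) * Real.exp (-(T + (d.1 + d.2.2) / 2))) * D ^ (β.re - 2) := by positivity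
  calc Real.exp (-Te) * (Real.exp ((d.1 + d.2.2) / 2) * Real.exp (-(T + (d.1 + d.2.2) / 2))) * (p₂ ^ (a - 2) * D ^ (β.re - 2))
      = (Real.exp (-Te) * (Real.exp ((d.1 + d.2.2) / 2) * Real.exp (-(T + (d.1 + d.2.2) / 2))) * D ^ (β.re - 2)) * p₂ ^ (a - 2) := by
        ring
    _ ≤ (Real.exp (-Te) * (Real.exp ((d.1 + d.2.2) / 2) * Real.exp (-(T + (d.1 + d.2.2) / 2))) * D ^ (β.re - 2)) *
          ((2 * (1 + (e.1 + e.2.2))) ^ (2 * (a - 2)) * pI ^ (2 * a - 2 - 2)) := mul_le_mul_of_nonneg_left hpow h0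
    _ = Real.exp (-Te) * (2 * (1 + (e.1 + e.2.2))) ^ (2 * (a - 2)) *
          (Real.exp ((d.1 + d.2.2) / 2) * (Real.exp (-(T + (d.1 + d.2.2) / 2)) * (pI ^ (2 * a - 2 - 2) * D ^ (β.re - 2)))) := by ring

/-- THE BOUND AT A REAL EXPONENT `a < 2`: `|η-int(a)(u + h)| ≤ e^{−τ(hg)} det(h)^{a−2} · |Siegel–Gindikin integrand(g, re β)(u)|`. -/
theorem norm_etaTwoIntegrand_add_le_of_lt_two (d : ℝ × ℂ × ℝ) {e : ℝ × ℂ × ℝ} (he : (hermTwo e).PosDef) {u : ℝ × ℂ × ℝ}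
    (hu : (hermTwo u).PosDef) {a : ℝ} (ha2 : a < 2) (β : ℂ) :
    ‖etaTwoIntegrand (hermTwo d) (hermTwo e) (a : ℂ) β (u + e)‖ ≤
      (Real.exp (-(e.1 * d.1 + e.2.2 * d.2.2 + 2 * (e.2.1 * conj d.2.1).re)) * (e.1 * e.2.2 - normSq e.2.1) ^ (a - 2)) *
        ‖cexp (-(hermTwo u * hermTwo d).trace) * (hermTwo u).det ^ ((β.re : ℂ) - 2)‖ := by
  have hu' := (posDef_hermTwo_iff u).mp hu
  have heh := (posDef_hermTwo_iff e).mp he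
  obtain ⟨x, z, y⟩ := u
  obtain ⟨hx, hz⟩ := hu'
  have he2 : 0 < e.2.2 := snd_pos_of_cone heh.1 heh.2
  rw [norm_etaTwoIntegrand_add d he hx hz, ofReal_re]
  set T : ℝ := x * d.1 + y * d.2.2 + 2 * (z * conj d.2.1).re with hT
  set Te : ℝ := e.1 * d.1 + e.2.2 * d.2.2 + 2 * (e.2.1 * conj d.2.1).re with hTe
  set p₂ : ℝ := (x + (e.1 + e.1)) * (y + (e.2.2 + e.2.2)) - normSq (z + (e.2.1 + e.2.1)) with hp₂
  set D : ℝ := x * y - normSq z with hD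
  have hDpos : 0 < D := by rw [hD]; linarith
  have hδ : 0 < e.1 * e.2.2 - normSq e.2.1 := by linarith [heh.2]
  -- `det h ≤ det 2h ≤ p₂`
  have hle : e.1 * e.2.2 - normSq e.2.1 ≤ p₂ := by
    have h2e := (posDef_hermTwo_iff (e + e)).mp (by rw [hermTwo_add]; exact he.add he)
    have := det_add_ge (w := (e + e).2.1) (q := (e + e).2.2) hx hz h2e.1 h2e.2
    simp only [Prod.fst_add, Prod.snd_add] at this
    have h4 : normSq (e.2.1 + e.2.1) = 4 * normSq e.2.1 := by
      rw [show e.2.1 + e.2.1 = (2 : ℂ) * e.2.1 by ring, map_mul, show normSq (2 : ℂ) = 4 by norm_num [normSq_apply]]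
    rw [hp₂]
    nlinarith [this, h4, show normSq (e + e).2.1 = normSq (e.2.1 + e.2.1) by rfl,
      show (e + e).1 * (e + e).2.2 = (e.1 + e.1) * (e.2.2 + e.2.2) by rfl, Complex.normSq_nonneg e.2.1, mul_pos heh.1 he2]
  have hpow : p₂ ^ (a - 2) ≤ (e.1 * e.2.2 - normSq e.2.1) ^ (a - 2) := Real.rpow_le_rpow_of_nonpos hδ hle (by linarith)
  -- the Siegel–Gindikin norm
  have hR : ‖cexp (-(hermTwo (x, z, y) * hermTwo d).trace) * (hermTwo (x, z, y)).det ^ ((β.re : ℂ) - 2)‖ = Real.exp (-T) * D ^ (β.re - 2) := by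
    rw [norm_mul, Complex.norm_exp, trace_hermTwo_mul_hermTwo, det_hermTwo, norm_cpow_eq_rpow_re_of_pos hDpos]
    simp only [neg_re, ofReal_re, sub_re, re_ofNat, hT, hD]
  rw [hR]
  have h0 : 0 ≤ Real.exp (-(T + Te)) * D ^ (β.re - 2) := by positivity
  calc Real.exp (-(T + Te)) * (p₂ ^ (a - 2) * D ^ (β.re - 2)) = (Real.exp (-(T + Te)) * D ^ (β.re - 2)) * p₂ ^ (a - 2) := by ring
    _ ≤ (Real.exp (-(T + Te)) * D ^ (β.re - 2)) * (e.1 * e.2.2 - normSq e.2.1) ^ (a - 2) := mul_le_mul_of_nonneg_left hpow h0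
    _ = Real.exp (-Te) * (e.1 * e.2.2 - normSq e.2.1) ^ (a - 2) * (Real.exp (-T) * D ^ (β.re - 2)) := by
        rw [neg_add, Real.exp_add]
        ring

/-! ## The integral bound at a real exponent -/

/-- THE INTEGRAL BOUND AT A REAL EXPONENT `a`: `∫_{u>0} |η-int(a)(u + h)| du ≤ C(g, a, β) · e^{−τ(hg)} · (1 + tr h)^{2(a−2)⁺} · det(h)^{−(2−a)⁺}`
for every `h > 0`, with `C` independent of `h`. -/
theorem integral_norm_etaTwoIntegrand_add_le {d : ℝ × ℂ × ℝ} (hd : 0 < d.1 ∧ normSq d.2.1 < d.1 * d.2.2) {β : ℂ} (hβ : 1 < β.re)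
    (a : ℝ) : ∃ C : ℝ, 0 ≤ C ∧ ∀ e : ℝ × ℂ × ℝ, (hermTwo e).PosDef →
      ∫ u in {c : ℝ × ℂ × ℝ | (hermTwo c).PosDef}, ‖etaTwoIntegrand (hermTwo d) (hermTwo e) (a : ℂ) β (u + e)‖ ≤
        C * Real.exp (-(e.1 * d.1 + e.2.2 * d.2.2 + 2 * (e.2.1 * conj d.2.1).re)) *
          ((1 + (e.1 + e.2.2)) ^ (2 * max (a - 2) 0) * (e.1 * e.2.2 - normSq e.2.1) ^ (-max (2 - a) 0)) := by
  have hg : (hermTwo d).PosDef := (posDef_hermTwo_iff d).mpr hd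
  rcases le_or_gt 2 a with ha2 | ha2
  · -- `a ≥ 2`: compare with `η(g, ½; 2a − 2, β)`
    have hι : (hermTwo ((1 / 2 : ℝ), (0 : ℂ), (1 / 2 : ℝ))).PosDef := (posDef_hermTwo_iff _).mpr (by norm_num)
    have hint := (integrableOn_etaTwoIntegrand_comp_add hg hι (((2 * a - 2 : ℝ)) : ℂ) hβ).norm
    have hI0 : 0 ≤ ∫ u in {c : ℝ × ℂ × ℝ | (hermTwo c).PosDef}, ‖etaTwoIntegrand (hermTwo d) (hermTwo ((1 / 2 : ℝ), (0 : ℂ), (1 / 2 : ℝ)))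
        ((2 * a - 2 : ℝ) : ℂ) β (u + ((1 / 2 : ℝ), (0 : ℂ), (1 / 2 : ℝ)))‖ := integral_nonneg fun _ => norm_nonneg _
    refine ⟨(2 : ℝ) ^ (2 * (a - 2)) * (Real.exp ((d.1 + d.2.2) / 2) *
      ∫ u in {c : ℝ × ℂ × ℝ | (hermTwo c).PosDef}, ‖etaTwoIntegrand (hermTwo d) (hermTwo ((1 / 2 : ℝ), (0 : ℂ), (1 / 2 : ℝ)))
        ((2 * a - 2 : ℝ) : ℂ) β (u + ((1 / 2 : ℝ), (0 : ℂ), (1 / 2 : ℝ)))‖), by positivity, fun e he => ?_⟩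
    have heh := (posDef_hermTwo_iff e).mp he
    have he2 : 0 < e.2.2 := snd_pos_of_cone heh.1 heh.2
    have hmono := setIntegral_mono_on (integrableOn_etaTwoIntegrand_comp_add hg he (a : ℂ) hβ).norm
      ((hint.const_mul _).const_mul
        (Real.exp (-(e.1 * d.1 + e.2.2 * d.2.2 + 2 * (e.2.1 * conj d.2.1).re)) * (2 * (1 + (e.1 + e.2.2))) ^ (2 * (a - 2))))
      measurableSet_posDef_hermTwo fun u hu => norm_etaTwoIntegrand_add_le_of_two_le d he hu ha2 β
    rw [integral_const_mul, integral_const_mul] at hmono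
    rw [max_eq_left (by linarith : (0 : ℝ) ≤ a - 2), max_eq_right (by linarith : 2 - a ≤ (0 : ℝ)), neg_zero, Real.rpow_zero,
      mul_one]
    rw [Real.mul_rpow (by norm_num : (0 : ℝ) ≤ 2) (by linarith : (0 : ℝ) ≤ 1 + (e.1 + e.2.2))] at hmono
    calc _ ≤ _ := hmono
      _ = _ := by ring
  · -- `a < 2`: compare with the Siegel–Gindikin integrand at `(g, re β)`
    have hint := (integrableOn_siegelGindikin_hermTwo d hd (s := (β.re : ℂ)) (by simpa using hβ)).norm
    have hI0 : 0 ≤ ∫ u in {c : ℝ × ℂ × ℝ | (hermTwo c).PosDef},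
        ‖cexp (-(hermTwo u * hermTwo d).trace) * (hermTwo u).det ^ ((β.re : ℂ) - 2)‖ := integral_nonneg fun _ => norm_nonneg _
    refine ⟨∫ u in {c : ℝ × ℂ × ℝ | (hermTwo c).PosDef}, ‖cexp (-(hermTwo u * hermTwo d).trace) * (hermTwo u).det ^ ((β.re : ℂ) - 2)‖,
      hI0, fun e he => ?_⟩
    have heh := (posDef_hermTwo_iff e).mp he
    have he2 : 0 < e.2.2 := snd_pos_of_cone heh.1 heh.2
    have hmono := setIntegral_mono_on (integrableOn_etaTwoIntegrand_comp_add hg he (a : ℂ) hβ).norm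
      (hint.const_mul (Real.exp (-(e.1 * d.1 + e.2.2 * d.2.2 + 2 * (e.2.1 * conj d.2.1).re)) * (e.1 * e.2.2 - normSq e.2.1) ^ (a - 2)))
      measurableSet_posDef_hermTwo fun u hu => norm_etaTwoIntegrand_add_le_of_lt_two d he hu ha2 β
    rw [integral_const_mul] at hmono
    rw [max_eq_right (by linarith : a - 2 ≤ (0 : ℝ)), max_eq_left (by linarith : (0 : ℝ) ≤ 2 - a), mul_zero, Real.rpow_zero,
      one_mul, neg_sub]
    calc _ ≤ _ := hmono
      _ = _ := by ring

/-! ## The growth estimate -/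

/-- **GROWTH OF `η(g, h; α, β)` IN `h`, UNIFORMLY ON `α`-STRIPS** (organ Φ6b-4 (c); the estimate behind [Shimura1982, Thm 3.1 (ii)], Case II,
m = 2): for `g > 0`, `re β > 1` and `a₁ ≤ a₂` there is `C ≥ 0` such that for every positive definite `h` and every `α` with `a₁ ≤ re α ≤ a₂`,
  `|η(g, h; α, β)| ≤ C · e^{−Re tr(hg)} · (1 + tr h)^{2(a₂−2)⁺} · (1 + det(h)^{−(2−a₁)⁺})`. -/
theorem norm_etaTwo_le {g : Matrix (Fin 2) (Fin 2) ℂ} (hg : g.PosDef) {β : ℂ} (hβ : 1 < β.re) {a₁ a₂ : ℝ} (h12 : a₁ ≤ a₂) :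
    ∃ C : ℝ, 0 ≤ C ∧ ∀ h : Matrix (Fin 2) (Fin 2) ℂ, h.PosDef → ∀ α : ℂ, a₁ ≤ α.re → α.re ≤ a₂ →
      ‖etaTwo g h α β‖ ≤ C * Real.exp (-((h * g).trace).re) *
        ((1 + ((h 0 0).re + (h 1 1).re)) ^ (2 * max (a₂ - 2) 0) * (1 + ((h 0 0).re * (h 1 1).re - normSq (h 0 1)) ^ (-max (2 - a₁) 0))) := by
  obtain ⟨d, rfl⟩ : ∃ d : ℝ × ℂ × ℝ, hermTwo d = g := ⟨_, hermTwo_eq_of_isHermitian hg.1⟩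
  have hd := (posDef_hermTwo_iff d).mp hg
  obtain ⟨C₁, hC₁, hB₁⟩ := integral_norm_etaTwoIntegrand_add_le hd hβ a₁
  obtain ⟨C₂, hC₂, hB₂⟩ := integral_norm_etaTwoIntegrand_add_le hd hβ a₂
  refine ⟨C₁ + C₂, by positivity, fun h hh α hα₁ hα₂ => ?_⟩
  obtain ⟨e, rfl⟩ : ∃ e : ℝ × ℂ × ℝ, hermTwo e = h := ⟨_, hermTwo_eq_of_isHermitian hh.1⟩
  have heh := (posDef_hermTwo_iff e).mp hh
  have he2 : 0 < e.2.2 := snd_pos_of_cone heh.1 heh.2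
  have hδ : 0 < e.1 * e.2.2 - normSq e.2.1 := by linarith [heh.2]
  simp only [trace_hermTwo_mul_hermTwo, hermTwo_apply_zero_zero, hermTwo_apply_one_one, hermTwo_apply_zero_one, ofReal_re]
  -- `|η| ≤ ∫ |η-int(α)| ≤ ∫ (|η-int(a₁)| + |η-int(a₂)|)`
  have hI := (integrableOn_etaTwoIntegrand_comp_add hg hh α hβ).norm
  have hI₁ := (integrableOn_etaTwoIntegrand_comp_add hg hh (a₁ : ℂ) hβ).norm
  have hI₂ := (integrableOn_etaTwoIntegrand_comp_add hg hh (a₂ : ℂ) hβ).norm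
  have step1 : ‖etaTwo (hermTwo d) (hermTwo e) α β‖ ≤
      ∫ u in {c : ℝ × ℂ × ℝ | (hermTwo c).PosDef}, ‖etaTwoIntegrand (hermTwo d) (hermTwo e) α β (u + e)‖ := by
    rw [etaTwo_eq_integral_comp_add (hermTwo d) hh.posSemidef]
    exact norm_integral_le_integral_norm _
  have step2 : ∫ u in {c : ℝ × ℂ × ℝ | (hermTwo c).PosDef}, ‖etaTwoIntegrand (hermTwo d) (hermTwo e) α β (u + e)‖ ≤
      ∫ u in {c : ℝ × ℂ × ℝ | (hermTwo c).PosDef}, (‖etaTwoIntegrand (hermTwo d) (hermTwo e) (a₁ : ℂ) β (u + e)‖ +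
        ‖etaTwoIntegrand (hermTwo d) (hermTwo e) (a₂ : ℂ) β (u + e)‖) :=
    setIntegral_mono_on hI (hI₁.add hI₂) measurableSet_posDef_hermTwo
      fun u hu => norm_etaTwoIntegrand_add_le_add d hh hu (β := β) hα₁ hα₂
  rw [integral_add hI₁ hI₂] at step2
  have hB₁' := hB₁ e hh
  have hB₂' := hB₂ e hh
  -- monotonicity of the two profile factors in the exponents
  have hE : (1 : ℝ) ≤ 1 + (e.1 + e.2.2) := by linarith [heh.1]
  have hP : 0 ≤ (1 + (e.1 + e.2.2)) ^ (2 * max (a₂ - 2) 0) := Real.rpow_nonneg (by linarith) _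
  have hQ : 0 ≤ 1 + (e.1 * e.2.2 - normSq e.2.1) ^ (-max (2 - a₁) 0) := by
    linarith [Real.rpow_nonneg hδ.le (-max (2 - a₁) 0)]
  have hm₁ : (1 + (e.1 + e.2.2)) ^ (2 * max (a₁ - 2) 0) ≤ (1 + (e.1 + e.2.2)) ^ (2 * max (a₂ - 2) 0) :=
    Real.rpow_le_rpow_of_exponent_le hE (by linarith [max_le_max (sub_le_sub_right h12 2) (le_refl (0 : ℝ))])
  have hn₁ : (e.1 * e.2.2 - normSq e.2.1) ^ (-max (2 - a₁) 0) ≤ 1 + (e.1 * e.2.2 - normSq e.2.1) ^ (-max (2 - a₁) 0) := by linarith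
  have hn₂ : (e.1 * e.2.2 - normSq e.2.1) ^ (-max (2 - a₂) 0) ≤ 1 + (e.1 * e.2.2 - normSq e.2.1) ^ (-max (2 - a₁) 0) := by
    have h := Literature.Dynamics.TransferOperators.rpow_neg_le_add (a := max (2 - a₂) 0) (a₁ := 0) (a₂ := max (2 - a₁) 0) hδ
      (le_max_right _ _) (max_le_max (by linarith) (le_refl (0 : ℝ)))
    rwa [neg_zero, Real.rpow_zero] at h
  have key₁ : (1 + (e.1 + e.2.2)) ^ (2 * max (a₁ - 2) 0) * (e.1 * e.2.2 - normSq e.2.1) ^ (-max (2 - a₁) 0) ≤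
      (1 + (e.1 + e.2.2)) ^ (2 * max (a₂ - 2) 0) * (1 + (e.1 * e.2.2 - normSq e.2.1) ^ (-max (2 - a₁) 0)) :=
    mul_le_mul hm₁ hn₁ (Real.rpow_nonneg hδ.le _) hP
  have key₂ : (1 + (e.1 + e.2.2)) ^ (2 * max (a₂ - 2) 0) * (e.1 * e.2.2 - normSq e.2.1) ^ (-max (2 - a₂) 0) ≤
      (1 + (e.1 + e.2.2)) ^ (2 * max (a₂ - 2) 0) * (1 + (e.1 * e.2.2 - normSq e.2.1) ^ (-max (2 - a₁) 0)) :=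
    mul_le_mul_of_nonneg_left hn₂ hP
  have hX₁ := mul_le_mul_of_nonneg_left key₁
    (mul_nonneg hC₁ (Real.exp_pos (-(e.1 * d.1 + e.2.2 * d.2.2 + 2 * (e.2.1 * conj d.2.1).re))).le)
  have hX₂ := mul_le_mul_of_nonneg_left key₂
    (mul_nonneg hC₂ (Real.exp_pos (-(e.1 * d.1 + e.2.2 * d.2.2 + 2 * (e.2.1 * conj d.2.1).re))).le)
  linarith [step1, step2, hB₁', hB₂', hX₁, hX₂]

end Summit.HodgeConjecture.HodgeConjecture.Cruxes.HLiu418.K2LiuHermTwoEtaGrowth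

end
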